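import Summits.Ventures.HodgeRepro2.HeckeCommuteNormalizer

/-!
# HeckeCommutingPair — a normalising element commuting with `δ` gives a commuting pair of Hecke operators;
`T_δ = id` for `δ ∈ S` (p2 annex row 167)

Cell pub-hodge-repro2, Tier 5 kernel annex (seat p2, Shimura-data / Hecke side). Proof lane (no new definition).
§8(d): uses an L-value-free non-vanishing device: NO.

* `doubleCoset_mul_eq_of_commute` — `β` normalising `S` and `βα = αβ` ⇒ `S βα S = S αβ S` (row 159's
  `doubleCoset_mul_eq_of_conj_mem` with `βαβ⁻¹ = α ∈ SαS`).
* `hecke_comm_of_normalizes_of_commute` / `heckeFamilyOf_comm_of_normalizes_of_commute` — the commutation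
  `T_α T_β = T_β T_α` on the ball and on the Petersson space for a normalising `β` commuting with `α` (the general
  form of row 163's `w`/`δ₄` commutation).
* `exists_atkinLehner_split_of_commute` — the Atkin–Lehner splitting of a `T_α`-eigenvector for a normalising
  involution `w` commuting with `α`.
* `hecke_eq_self_of_mem` — for `δ ∈ S` the Hecke operator `T_δ` is the identity on the weight-`k` forms for `S`
  on the ball (`S_δ = S`, `T_δ f = f∥δ = f`).

No `sorry`; `#print axioms` ⊆ {propext, Classical.choice, Quot.sound}.
-/

namespace Summit.Ventures.HodgeRepro2.ShimuraData

variable {K : Type*} [Field K]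

/-- `β` normalising `S` and commuting with `α` ⇒ `S βα S = S αβ S`. -/
theorem doubleCoset_mul_eq_of_commute {S : Subgroup (GL (Fin 3) K)} {β α : GL (Fin 3) K}
    (hβ : ∀ s : GL (Fin 3) K, s ∈ S ↔ β * s * β⁻¹ ∈ S) (hc : β * α = α * β) :
    doubleCoset S (β * α) = doubleCoset S (α * β) := by
  apply doubleCoset_mul_eq_of_conj_mem hβ
  rw [hc, mul_inv_cancel_right]
  exact mem_doubleCoset_self S α

variable [NumberField K] [NumberField.IsCMField K] {τ₁ : K →+* ℂ} {H : Matrix (Fin 3) (Fin 3) K}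
  {Q : Matrix (Fin 3) (Fin 3) ℂ}

/-- `T_α (T_β f) = T_β (T_α f)` on the ball for `β ∈ U(H)(K)` normalising `S` and commuting with `α ∈ U(H)(K)`. -/
theorem hecke_comm_of_normalizes_of_commute (hQ : IsFrame K τ₁ H Q) {S : Subgroup (GL (Fin 3) K)}
    (hS : (S : Set (GL (Fin 3) K)) ⊆ unitaryGroup K H) {β α : GL (Fin 3) K}
    (hβ : ∀ s : GL (Fin 3) K, s ∈ S ↔ β * s * β⁻¹ ∈ S) (hβU : β ∈ unitaryGroup K H)
    (hαU : α ∈ unitaryGroup K H) (hc : β * α = α * β)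
    [Fintype (S ⧸ (heckeSubgroup S α).subgroupOf S)] [Fintype (S ⧸ (heckeSubgroup S β).subgroupOf S)]
    [Fintype (S ⧸ (heckeSubgroup S (β * α)).subgroupOf S)]
    [Fintype (S ⧸ (heckeSubgroup S (α * β)).subgroupOf S)] {k : ℕ} {f : (Fin 2 → ℂ) → ℂ}
    (hf : IsWeightFor τ₁ Q S k f) {z : Fin 2 → ℂ} (hz : z ∈ ball₂) :
    hecke S α τ₁ Q k (hecke S β τ₁ Q k f) z = hecke S β τ₁ Q k (hecke S α τ₁ Q k f) z :=
  hecke_comm_of_normalizes_of_doubleCoset_eq hQ hS hβ hβU hαU (doubleCoset_mul_eq_of_commute hβ hc) hf hz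

/-- For `δ ∈ S`, `T_δ f = f` on the ball for every weight-`k` form `f` for `S` (`S_δ = S` and `T_δ f = f∥δ`). -/
theorem hecke_eq_self_of_mem (hQ : IsFrame K τ₁ H Q) {S : Subgroup (GL (Fin 3) K)}
    (hS : (S : Set (GL (Fin 3) K)) ⊆ unitaryGroup K H) {δ : GL (Fin 3) K} (hδ : δ ∈ S)
    [Fintype (S ⧸ (heckeSubgroup S δ).subgroupOf S)] {k : ℕ} {f : (Fin 2 → ℂ) → ℂ}
    (hf : IsWeightFor τ₁ Q S k f) {z : Fin 2 → ℂ} (hz : z ∈ ball₂) :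
    hecke S δ τ₁ Q k f z = f z := by
  have hnorm : ∀ s : GL (Fin 3) K, s ∈ S ↔ δ * s * δ⁻¹ ∈ S := fun s =>
    ⟨fun hs => mul_mem (mul_mem hδ hs) (inv_mem hδ),
      fun hs => by simpa [mul_assoc] using mul_mem (mul_mem (inv_mem hδ) hs) hδ⟩
  rw [hecke_eq_slash_of_normalizes hQ hS hnorm (hS hδ) hf hz]
  -- `f∥δ = f` for `δ ∈ S`: the weight-`k` invariance, through `slash_realEmbedding_mul_left` with `α = 1`
  have h1 := slash_realEmbedding_mul_left hQ hS hf hδ (one_mem _) hz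
  rw [mul_one, hQ.realEmbedding_one, slash_one] at h1
  exact h1

section PeterssonSpace

variable (hQ : IsFrame K τ₁ H Q) (S : Subgroup (GL (Fin 3) K)) (hS : (S : Set (GL (Fin 3) K)) ⊆ unitaryGroup K H)
  [CompactSpace (ballQuotient hQ S hS)] {D : Set ball₂} (k : ℕ) (hD : IsBallFundamentalDomain hQ S hS D)
  (hDm : MeasurableSet D)
  (inst : ∀ δ : unitaryGroup K H, Fintype (S ⧸ (heckeSubgroup S (δ : GL (Fin 3) K)).subgroupOf S))

/-- `T_α` and `T_β` commute on the Petersson space for a normalising `β` commuting with `α`. -/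
theorem heckeFamilyOf_comm_of_normalizes_of_commute {β α : unitaryGroup K H}
    (hβ : ∀ s : GL (Fin 3) K, s ∈ S ↔ (β : GL (Fin 3) K) * s * (β : GL (Fin 3) K)⁻¹ ∈ S)
    (hc : (β : GL (Fin 3) K) * α = α * β) (v : PeterssonSpace hQ S hS k hD) :
    heckeFamilyOf hQ S hS k hD hDm inst α (heckeFamilyOf hQ S hS k hD hDm inst β v) =
      heckeFamilyOf hQ S hS k hD hDm inst β (heckeFamilyOf hQ S hS k hD hDm inst α v) :=
  heckeFamilyOf_comm_of_normalizes_of_doubleCoset_eq hQ S hS k hD hDm inst hβ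
    (doubleCoset_mul_eq_of_commute hβ hc) v

/-- The Atkin–Lehner splitting of a `T_α`-eigenvector for a normalising involution `w` commuting with `α`. -/
theorem exists_atkinLehner_split_of_commute {w α : unitaryGroup K H}
    (hw : ∀ s : GL (Fin 3) K, s ∈ S ↔ (w : GL (Fin 3) K) * s * (w : GL (Fin 3) K)⁻¹ ∈ S)
    (hw2 : (w : GL (Fin 3) K) * w = 1) (hc : (w : GL (Fin 3) K) * α = α * w)
    {v : PeterssonSpace hQ S hS k hD} {μ : ℂ} (hv : heckeFamilyOf hQ S hS k hD hDm inst α v = μ • v) :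
    ∃ vp vm : PeterssonSpace hQ S hS k hD, v = (2 : ℂ)⁻¹ • (vp + vm) ∧
      heckeFamilyOf hQ S hS k hD hDm inst w vp = vp ∧
      heckeFamilyOf hQ S hS k hD hDm inst w vm = -vm ∧
      heckeFamilyOf hQ S hS k hD hDm inst α vp = μ • vp ∧
      heckeFamilyOf hQ S hS k hD hDm inst α vm = μ • vm :=
  exists_atkinLehner_split hQ S hS k hD hDm inst hw hw2
    (by rw [hc, mul_inv_cancel_right]; exact mem_doubleCoset_self _ _) hv

end PeterssonSpace

end Summit.Ventures.HodgeRepro2.ShimuraData
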